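import Summits.ResolutionOfSingularities.ResolutionOfSingularities.Theorems.HilbertSamuelEliminationSigmaMaxModificationsCorridor3SigmaMenuStrategy
import Summits.ResolutionOfSingularities.ResolutionOfSingularities.Theorems.HilbertSamuelEliminationSigmaMaxModificationsCorridor3SigmaMenuCorners
import HarnessLib

/-!
# [OURS · L1 W4.2] σ-LAYER — `Corridor3SigmaMenuStrategyCorners`: the PAIR CLAUSE AS A MENU CLAUSE (RULING v3.14-16 (EK) «o1 carries
# `Boundary.PairsMeetNewFinite E C` as a CentreMenu clause in a later additive rev»), the transversal type `IsMenuDisciplinedT`, and E4d for it BY NAME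

Crux chain w42 (`SigmaMaxModifications`, stmt-ResolutionOfSingularities-18506; conjunct `SigmaMaxModificationsCorridor3`, stmt-ResolutionOfSingularities-19249),
σ-layer (E2′)/(E4d). Typer res-L1-type-o1 (OURS typer G4) over its `…SigmaMenuDiscipline` / `…SigmaMenuStrategy` (p526241 / p527045: `CentreMenu`,
`IsDisciplinedBy`, `StrategyE.hybrid`, `plusMenu`, `StrategyE.IsMenuDisciplined`) and res-type-067's `…SigmaMenuCorners` rev 2 (p529497: `Boundary.PairsMeetNewFinite`,
`StrategyE.RespectsPairClauseOn`, `InScopeMσE.tripleMeetsFinite` / `.fullCornerLocus_finite` — the run-level propagation is 067's and is CONSUMED here, not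
re-proved) / `…SigmaMenuPlus` rev 2 (p526950: `IsMenuCentrePlusAt`). OURS (cell res-hironaka, slot W4.2); NOT statements of H. Hironaka's manuscript
[Hironaka2017] nor of [CossartJannsenSaito2020]; AI-typed, weaker than expert review. Helper `--supports stmt-ResolutionOfSingularities-19249 --as helper`
(counted 0). Definitions + proved glue; NO row is claimed.

## Contents (namespace `…Theorems.SigmaMaxModificationsCorridor3.Sigma`)

* `plusMenu_iff_isMenuCentrePlusAt` — my `plusMenu` (p527045) IS 067's `IsMenuCentrePlusAt` (p526950), by `Iff.rfl`.
* `CentreMenu.transversal M` — a menu refined by the pair clause (`M … ∧ E.PairsMeetNewFinite C`); `plusMenuT := plusMenu.transversal`; the TRANSVERSAL TYPE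
  `StrategyE.IsMenuDisciplinedT := IsDisciplinedBy plusMenuT` (⇒ `IsMenuDisciplined`).
* `IsDisciplinedBy.respectsPairClauseOn_of_transversal` — discipline by a transversal menu gives 067's `RespectsPairClauseOn 𝒮` on EVERY scope;
  `RespectsPairClauseOn.hybrid` — the hybrid of two pair-respecting strategies respects the pair clause.
* E4d BY NAME for the transversal type and its hybrids: `IsMenuDisciplinedT.fullCornerLocus_finite[_hybrid]` (067's `InScopeMσE.fullCornerLocus_finite`).
-/

noncomputable section

set_option linter.dupNamespace false

open CategoryTheory AlgebraicGeometry TopologicalSpace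
open Summit.ResolutionOfSingularities.ResolutionOfSingularities.Theorems.CampaignW42
open Literature.AlgebraicGeometry.Resolution Literature.RingTheory.HilbertSamuel

namespace Summit.ResolutionOfSingularities.ResolutionOfSingularities.Theorems.SigmaMaxModificationsCorridor3.Sigma

universe u

/-! ## §0. Bridge: `plusMenu` is res-type-067's `IsMenuCentrePlusAt` -/

/-- My `plusMenu` (…SigmaMenuStrategy) and res-type-067's `IsMenuCentrePlusAt` (…SigmaMenuPlus rev 2) are the same predicate. [folklore] -/
theorem plusMenu_iff_isMenuCentrePlusAt {W : Scheme.{u}} (E : Boundary W) (N : ℕ) (ν : ℕ → ℕ) (x : W) (C : W.IdealSheafData) :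
    plusMenu W E N ν x C ↔ IsMenuCentrePlusAt E N ν x C :=
  Iff.rfl

/-! ## §1. The pair clause as a menu clause; the transversal type -/

/-- [OURS · L1 W4.2] **THE TRANSVERSAL REFINEMENT of a menu**: the menu clause AND res-type-067's per-step pair clause `E.PairsMeetNewFinite C` (RULING
v3.14-16 (EK): the clause the corner discipline carries; automatic on the toric scope). NOT a statement of the manuscript. [folklore] -/
def CentreMenu.transversal (M : CentreMenu.{u}) : CentreMenu.{u} :=
  fun W E N ν x C => M W E N ν x C ∧ E.PairsMeetNewFinite C

variable {M : CentreMenu.{u}} {N : ℕ} {ν : ℕ → ℕ} {σ τ π : StrategyE.{u}}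
  {𝒮 : ∀ (W : Scheme.{u}), IsLocallyNoetherian W → Labelling W → Option (Pending W) → Boundary W → Prop}

/-- The transversal refinement is a sub-menu. [folklore] -/
theorem CentreMenu.of_transversal {W : Scheme.{u}} {E : Boundary W} {x : W} {C : W.IdealSheafData} (h : M.transversal W E N ν x C) :
    M W E N ν x C :=
  h.1

/-- Discipline by a transversal menu is discipline by the menu … [folklore] -/
theorem StrategyE.IsDisciplinedBy.of_transversal (h : σ.IsDisciplinedBy M.transversal N ν) : σ.IsDisciplinedBy M N ν :=
  h.mono fun _ _ _ _ hC => hC.1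

/-- … and gives res-type-067's pair clause on EVERY scope. [folklore] -/
theorem StrategyE.IsDisciplinedBy.respectsPairClauseOn_of_transversal (h : σ.IsDisciplinedBy M.transversal N ν)
    (𝒮 : ∀ (W : Scheme.{u}), IsLocallyNoetherian W → Labelling W → Option (Pending W) → Boundary W → Prop) :
    σ.RespectsPairClauseOn 𝒮 N ν := by
  intro W hW L P E _ C P' hstep
  obtain ⟨_, _, hC⟩ := h W hW L P E C P' hstep
  exact hC.2

/-- **The hybrid of two pair-respecting strategies respects the pair clause** (same scope). [folklore] -/
theorem StrategyE.RespectsPairClauseOn.hybrid (hπ : π.RespectsPairClauseOn 𝒮 N ν) (hτ : τ.RespectsPairClauseOn 𝒮 N ν) :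
    (π.hybrid τ).RespectsPairClauseOn 𝒮 N ν := by
  intro W hW L P E hS C P' hstep
  rcases StrategyE.hybrid_step_cases hstep with h | h
  · exact hπ W hW L P E hS C P' h
  · exact hτ W hW L P E hS C P' h

/-- [OURS · L1 W4.2] **THE TRANSVERSAL PLUS MENU**: Plus menu of record AND the pair clause. [folklore] -/
def plusMenuT : CentreMenu.{u} :=
  plusMenu.transversal

/-- [OURS · L1 W4.2] **`σ` IS MENU-DISCIPLINED WITH THE PAIR CLAUSE** (the transversal type). [folklore] -/
def StrategyE.IsMenuDisciplinedT (N : ℕ) (ν : ℕ → ℕ) (σ : StrategyE.{u}) : Prop :=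
  σ.IsDisciplinedBy plusMenuT N ν

/-- The transversal type refines the type of record. [folklore] -/
theorem StrategyE.IsMenuDisciplinedT.isMenuDisciplined (h : σ.IsMenuDisciplinedT N ν) : σ.IsMenuDisciplined N ν :=
  StrategyE.IsDisciplinedBy.of_transversal h

/-- The transversal type respects the pair clause on every scope. [folklore] -/
theorem StrategyE.IsMenuDisciplinedT.respectsPairClauseOn (h : σ.IsMenuDisciplinedT N ν)
    (𝒮 : ∀ (W : Scheme.{u}), IsLocallyNoetherian W → Labelling W → Option (Pending W) → Boundary W → Prop) :
    σ.RespectsPairClauseOn 𝒮 N ν :=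
  StrategyE.IsDisciplinedBy.respectsPairClauseOn_of_transversal h 𝒮

/-! ## §2. E4d BY NAME for the transversal type (res-type-067's `InScopeMσE.fullCornerLocus_finite`) -/

/-- **FINITELY MANY FULL CORNERS at every stage in scope of a transversally menu-disciplined strategy** started with the empty boundary: the corner
puzzle of each stage has finitely many boards. [folklore] -/
theorem StrategyE.IsMenuDisciplinedT.fullCornerLocus_finite {p : ℕ} (hσ : σ.IsMenuDisciplinedT N ν) {s : MarkedStageE.{u}}
    (h : InScopeMσE p σ N ν (fun _ _ => []) s) : (fullCornerLocus s.E N ν).Finite :=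
  h.fullCornerLocus_finite (hσ.respectsPairClauseOn _)

/-- **… and for the HYBRID** of a transversally menu-disciplined policy over a fallback respecting the pair clause on the hybrid's reachable scope.
[folklore] -/
theorem StrategyE.IsMenuDisciplinedT.fullCornerLocus_finite_hybrid {p : ℕ} (hπ : π.IsMenuDisciplinedT N ν)
    (hτ : τ.RespectsPairClauseOn (StrategyE.ReachableState p (π.hybrid τ) N ν fun _ _ => []) N ν)
    {s : MarkedStageE.{u}} (h : InScopeMσE p (π.hybrid τ) N ν (fun _ _ => []) s) : (fullCornerLocus s.E N ν).Finite :=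
  h.fullCornerLocus_finite ((hπ.respectsPairClauseOn _).hybrid hτ)

end Summit.ResolutionOfSingularities.ResolutionOfSingularities.Theorems.SigmaMaxModificationsCorridor3.Sigma

end
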